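import Summits.QuantumFields.BalabanUV.T4Continuum.Support.NE9EndOfRecordCentre
import Summits.QuantumFields.BalabanUV.T4Continuum.Support.NE9ChartReadOut

/-!
# NE9EndOfRecordReadOut — ROW NE9's END OF RECORD WITH THE READ-OUT BINDERS RO DISCHARGED: the marginal read-out `r U` of the END
# (`NE9MarginalProjection.margProj (r U) (A U)`) IS the shifted RECIPE of a finite chart-probe structure per real background
# (`NE9ChartReadOut.ChartProbes`, printed TYPE of [I] (1.20)–(1.22) through (4.3)), and the three displayed binders
# `hrA : ReadAdditive`, `hr0 : ReadZero`, `hrs : ReadSize … κ cr` + the letter `hcr` are REPLACED by: a chart radius `αr > 0`, the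
# locality letter `Kr` (displayed inequality, NOT PRINTED), and the class inclusion «admissible old terms are probe-analytic»; the read
# constant becomes `cr := 8·Kr∕αr²` (the Cauchy step of `T4BetaReadOutLipschitz` §3 re-run in the chart encoding, node U2's (R) BY SHAPE)
# (cell `pub-balaban`, T4-DAG §2 node U3 ∕ §6 NE9; BINDER row NE9 OWNER lineage `b2b-balaban-t4-ne9-p1`, generation 37; record §43.8 (b);
# WALL-NE9-P1 §2 row «MP RO AW»: RO ↦ K; MP `hPinto` and AW `hA` stay displayed; nothing of any import modified)

HONEST FRAMING (T4-DAG PAGE 1).  Rung (B)+1 of the FINITE-VOLUME T⁴ programme — NOT infinite volume, NOT a mass gap, NOT the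
Clay problem.  NE9 (`T4OutputRate.NE9` ∧ `FadingMemory`) is a cell NEW ESTIMATE, NOT PRINTED in [I] = [Balaban1987RG1]
(CMP **109**), [II] = [Balaban1988RG2Cluster] (CMP **116**), and NOT PROVED for Bałaban's E^{(j)} («NE9 ⇐ the named binders»;
spine PROVED 0∕9).  HONEST DEPENDENCY (cell line, verbatim): continuum YM on T⁴ ⇐ BetaPertH ∧ nine spine estimates (0/9 proved);
BetaPertH ⇐ (D1) ∧ (D4) ∧ CAP+tail; G-an2-4 gates asym, D1 and NE2/3/4.  `FlowStep.BetaPertH`, (B), (B^μ) do not occur.  ONE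
specialisation BY NAME of `NE9EndOfRecordCentre.termSize_ne9_and_fadingMemory_centre` (T26) with `r U := shiftRead (Pr U).recipe`,
`cr := 8·Kr∕αr²`, the RO binders supplied by `NE9ChartReadOut.readAdditive_shiftRead_recipe ∕ readZero_shiftRead_recipe ∕
readSize_shiftRead_recipe ∕ readConst_nonneg`.  Every other hypothesis verbatim (WALL-NE9-P1 §2 rows); conclusion LITERALLY the END's
`TermSize ∧ NE9 ∧ FadingMemory` with `cr` so instantiated.  Nothing printed is asserted (ABSOLUTE RULE); 0 sorry.

WHAT REMAINS DISPLAYED IN THE ROW «MP RO AW» after this file: MP `hPinto` (the projected admissible families are marginal-free — M at the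
instance), AW `hA ∕ haA` (size of the marginal direction — T elementary), and the NEW letters `hαr ∕ hKr ∕ hAn` (chart radius, locality sum,
probe-analyticity of the admissible class — the located inputs of node U2's (R), cell GAPS C-ne4p1-7: `cr` NOT PRINTED).

References (TYPES ∕ loci only): [Balaban1987RG1] T. Bałaban, CMP **109** (1987) 249–301, Thm 1 p. 259, (1.18) p. 263, (1.20)–(1.22)
p. 264, (2.13)–(2.14) p. 268, p. 270, (4.3)–(4.5) pp. 281–282; [Balaban1988RG2Cluster] T. Bałaban, CMP **116** (1988) 1–22, (1.23)–(1.29)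
pp. 7–8, (1.33)–(1.36) p. 9, (2.14)–(2.15) p. 15.  Summits-side NEW work (LEAN PLACEMENT RULE); imports `NE9EndOfRecordCentre` and
`NE9ChartReadOut` ONLY; modifies nothing.  Value = three displayed binders of the row's END discharged at form level, NOT summit progress.
-/

noncomputable section

namespace Summit.QuantumFields.BalabanUV.T4Continuum.NE9EndOfRecordReadOut

open scoped BigOperators ENNReal Matrix Matrix.Norms.L2Operator
open Metric Set
open Literature.Probability.LatticeModels
open Literature.MathematicalPhysics.QuantumFieldTheory.Balaban1983to89
open Literature.MathematicalPhysics.QuantumFieldTheory.Balaban1983to89.T4OutputRate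
open Literature.MathematicalPhysics.QuantumFieldTheory.Balaban1983to89.T4HistoryLipschitzRecursion
open Literature.MathematicalPhysics.QuantumFieldTheory.Balaban1983to89.T4HistoryLipschitzOuter
open Literature.MathematicalPhysics.QuantumFieldTheory.Balaban1983to89.T4HistoryLipschitzActivity
open Literature.MathematicalPhysics.QuantumFieldTheory.Balaban1983to89.T4HistoryLipschitzActivity (ClusterGeom)
open Literature.MathematicalPhysics.QuantumFieldTheory.Balaban1983to89.T4HistoryLipschitzSegment
open Summit.QuantumFields.BalabanUV.T4Continuum.B13Carriers (TwoRuns)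
open Summit.QuantumFields.BalabanUV.T4Continuum.B13DomainGeometryTR
open Summit.QuantumFields.BalabanUV.T4Continuum.B13OpDatum (OpDatum assemble)
open Summit.QuantumFields.BalabanUV.T4Continuum.NE9Lemma1Counting
open Summit.QuantumFields.BalabanUV.T4Continuum.NE9Lemma1Gain
open Summit.QuantumFields.BalabanUV.T4Continuum.NE9Lemma1PieceClass
open Summit.QuantumFields.BalabanUV.T4Continuum.NE9Lemma1RemainderSpecies
open Summit.QuantumFields.BalabanUV.T4Continuum.NE9Lemma1CurveSpecies
open Summit.QuantumFields.BalabanUV.T4Continuum.NE9Lemma1KernelSpecies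
open Summit.QuantumFields.BalabanUV.T4Continuum.NE9ComplexEncoding (doubleCarriers)
open Summit.QuantumFields.BalabanUV.T4Continuum.NE9MarginalProjection
open Summit.QuantumFields.BalabanUV.T4Continuum.NE9MarginalProjectionEnd
open Summit.QuantumFields.BalabanUV.T4Continuum.NE9ChannelSum
open Summit.QuantumFields.BalabanUV.T4Continuum.NE9SizeFedCoupling
open Summit.QuantumFields.BalabanUV.T4Continuum.NE9TableReading
open Summit.QuantumFields.BalabanUV.T4Continuum.NE9RecursionFunctional
open Summit.QuantumFields.BalabanUV.T4Continuum.NE9EndApplied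
open Summit.QuantumFields.BalabanUV.T4Continuum.NE9ChartFamilyPullback
open Summit.QuantumFields.BalabanUV.T4Continuum.NE9EndAppliedRealRow
open Summit.QuantumFields.BalabanUV.T4Continuum.NE9SpeciesFrameOfRecord
open Summit.QuantumFields.BalabanUV.T4Continuum.NE9SpeciesDataOfRecord
open Summit.QuantumFields.BalabanUV.T4Continuum.NE9SpeciesDataOfRecordAdmissible
open Summit.QuantumFields.BalabanUV.T4Continuum.NE9EndOfRecordSpecies
open Summit.QuantumFields.BalabanUV.T4Continuum.NE9SpeciesFrameConvention
open Summit.QuantumFields.BalabanUV.T4Continuum.NE9SpeciesDataConvention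
open Summit.QuantumFields.BalabanUV.T4Continuum.NE9EndOfRecordConvention
open Summit.QuantumFields.BalabanUV.T4Continuum.NE9EndOfRecordAct (GoR actOR)
open Summit.QuantumFields.BalabanUV.T4Continuum.NE9EndOfRecordActConvention
open Summit.QuantumFields.BalabanUV.T4Continuum.NE9EndOfRecordPrint
open Summit.QuantumFields.BalabanUV.T4Continuum.NE9EndOfRecordCentre
open Summit.QuantumFields.BalabanUV.T4Continuum.NE9ChartReadOut
open Summit.QuantumFields.BalabanUV.T4Continuum.NE9DoubledChart (dblChart)
open Summit.QuantumFields.BalabanUV.T4Continuum.B13CarriersCubeChart (cubeChart)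
open Summit.QuantumFields.BalabanUV.T4Continuum.B13HistDatum
open Summit.QuantumFields.BalabanUV.T4Continuum.B13HistMeasurable
open Summit.QuantumFields.BalabanUV.T4Continuum.B13StepTermLabels (InnerLabel)
open Summit.QuantumFields.BalabanUV.T4Continuum.B13InnerData (Bnd)
open Summit.QuantumFields.BalabanUV.T4Continuum.CovariantBlockAveraging (ContourSystem)
open Literature.MathematicalPhysics.QuantumFieldTheory.Balaban1983to89.B5Prop11Plancherel (Tor)
open Literature.MathematicalPhysics.QuantumFieldTheory.Balaban1983to89.B5G183RateUnitTower (lev)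
open Literature.MathematicalPhysics.QuantumFieldTheory.Balaban1983to89.T4HistoryLipschitzCubeGeometry (CubeChart)
open Summit.QuantumFields.BalabanUV.T4Continuum.SubstrateBackgroundTransporters (unitMod)
open Summit.QuantumFields.BalabanUV.T4Continuum.SubstrateTwoRunsDriven (DrivenRuns)
open Summit.QuantumFields.BalabanUV.T4Continuum.SubstrateTransporterSpecies (TowerData towerDataOf adjOf)
open Summit.QuantumFields.BalabanUV.T4Continuum.SubstrateSlotsOfRecord (SlotLetters slotsOfRecord slotsOfRecord_rawB slotsOfRecord_F)
open Summit.QuantumFields.BalabanUV.T4Continuum.NE9ChartFaceOperator (actChart rawTKernel towerPairChart vacPair oRecC_zero oRecC_of_lt)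
open Summit.QuantumFields.BalabanUV.T4Continuum.NE9ChartFaceTable (iRecC)
open Summit.QuantumFields.BalabanUV.T4Continuum.U3PolymerDictionaryNE9Face (actNE9 oRecLast)
open Summit.QuantumFields.BalabanUV.T4Continuum.U3PolymerDictionaryLift (liftFam)

variable {G₀ : Type} [GaugeGroup G₀] (D : DrivenRuns G₀)

/-! ## §1 The letters of the activities of record (as in `NE9EndOfRecordAct` ∕ `NE9EndOfRecordPrint` ∕ `NE9EndOfRecordCentre`) -/

variable {o : Type} [Fintype o] [DecidableEq o] (ιR : G₀ →* Matrix o o ℂ) (cR : ℂ) (aR : ℝ) (sR : ℕ → ℂ)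
variable {T ι' S Ω 𝒴 : Type} (P : MeasPotFrame D.carriers) {IOp : Type*}
  (𝒵 : D.carriers.Dom → InnerLabel D.carriers.Dom (Bnd D.toTwoRuns) → Type) [∀ Z j, Fintype (𝒵 Z j)]
  (dom : ∀ Z j, 𝒵 Z j → D.carriers.Dom)
  (Jc : D.carriers.Dom → InnerLabel D.carriers.Dom (Bnd D.toTwoRuns) → Type) [∀ Z j, Fintype (Jc Z j)]
  (VR : D.carriers.Dom → InnerLabel D.carriers.Dom (Bnd D.toTwoRuns) → Type) [∀ Z j, NormedAddCommGroup (VR Z j)]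
  [∀ Z j, InnerProductSpace ℝ (VR Z j)] [∀ Z j, MeasurableSpace (VR Z j)] [∀ Z j, BorelSpace (VR Z j)] [∀ Z j, FiniteDimensional ℝ (VR Z j)]
  (mI : D.carriers.Dom → InnerLabel D.carriers.Dom (Bnd D.toTwoRuns) → Type) [∀ Z j, Fintype (mI Z j)] [∀ Z j, DecidableEq (mI Z j)]
  (L : SlotLetters D (o := o) (T := T) (ι' := ι') (S := S) (Ω := Ω) (𝒴 := 𝒴) P (IOp := IOp) 𝒵 dom Jc VR mI)
  (dk : TowerData (D.F.P (D.K + 1)) o → TowerData (D.F.P (D.K + 1)) o → ℕ → T → ι' → ι' → ℂ)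
  (gc : TowerData (D.F.P (D.K + 1)) o → TowerData (D.F.P (D.K + 1)) o → ℕ → T →
    ((Tor (unitMod (D.F.P (D.K + 1))) × Fin (D.F.P (D.K + 1)).d) × o) → ι' → ℂ)
  (pQ : ℝ → TowerData (D.F.P (D.K + 1)) o → TowerData (D.F.P (D.K + 1)) o → ℕ → Ω → 𝒴 →
    ((Tor (unitMod (D.F.P (D.K + 1))) × Fin (D.F.P (D.K + 1)).d) × o) → ((Tor (unitMod (D.F.P (D.K + 1))) × Fin (D.F.P (D.K + 1)).d) × o) → ℂ)
  (pR : ℝ → TowerData (D.F.P (D.K + 1)) o → TowerData (D.F.P (D.K + 1)) o → ℕ → Ω → 𝒴 → ℂ)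
  (ρ : ℝ) {ι τ : Type} [Fintype τ] (cc : ℕ → TowerData (D.F.P (D.K + 1)) o → PotIdx P.toPotFrame → τ → ι) (wR : τ → ℂ)

/-! ## §2 The END of record with the read-out binders discharged -/

/-- **ROW NE9's END OF RECORD, READ-OUT BINDERS DISCHARGED.**  `NE9EndOfRecordCentre.termSize_ne9_and_fadingMemory_centre` with the
marginal read-out `r U := shiftRead (Pr U).recipe` of a finite chart-probe structure per real background and `cr := 8·Kr∕αr²`: the
binders `hrA hr0 hrs hcr` are supplied by `NE9ChartReadOut`; in their place the chart radius `hαr`, the locality letter `hKr` and the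
class inclusion `hAn` are displayed.  Conclusion LITERALLY the END's `TermSize ∧ NE9 ∧ FadingMemory`.
[cite: Balaban1987RG1, Thm 1 p.259, (1.18) p.263, (1.20)-(1.22) p.264, (2.13)-(2.14) p.268, (4.3)-(4.5) pp.281-282; Balaban1988RG2Cluster, (1.23)-(1.29) pp.7-8, (1.33)-(1.36) p.9, (2.14)-(2.15) p.15] -/
theorem termSize_ne9_and_fadingMemory_readOut {Pt : Type} [Nonempty ι] (U₁ : D.carriers.BgB)
    (𝔭 : SpeciesParams D.toTwoRuns D.carriers.BgB (TowerData (D.F.P (D.K + 1)) o) ι Pt)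
    {ιp : Type} (Pr : D.carriers.BgB → ChartProbes D.carriers (TowerData (D.F.P (D.K + 1)) o) ιp) {αr Kr : ℝ}
    {ℓg gain : ℕ → ℕ → ℝ} (ℓk : ℕ → ℕ → ℝ) {cdir cK δ₀ δ₁ w w0 c0 c1 cQa cQb : ℝ} {W : Set (ℕ → ℝ)}
    {Adm MF : D.carriers.BgB → Set (TowerData (D.F.P (D.K + 1)) o → (doubleCarriers D.carriers).Dom → ℝ)}
    {A : D.carriers.BgB → TowerData (D.F.P (D.K + 1)) o → (doubleCarriers D.carriers).Dom → ℝ}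
    {n : D.carriers.BgB → ℕ → ℝ → TowerData (D.F.P (D.K + 1)) o → Finset (SCube D.toTwoRuns) → ℝ} {lip clip : ℕ → ℝ} {a d : Finset (SCube D.toTwoRuns) → ℝ} {δv : (doubleCarriers D.carriers).Dom → ℝ}
    {κ B lipbar clipbar qTbar ω aA Nbar clipa lam : ℝ} {p₀ N : ℕ → ℝ}
    -- species (a): the analytic clauses of `CurData.Admissible` at the data of record, and the letters
    (hκ₁1 : 1 ≤ 𝔭.κ₁) (hrT : ∀ k, 0 < 𝔭.rT k) (hRad : ∀ X, 0 < 𝔭.Rad X)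
    (hcur : ∀ (U : D.carriers.BgB) (k : ℕ) (s : ℕ → ℝ) (y : ι) (a : SCube D.toTwoRuns) (b : Finset (SCube D.toTwoRuns)) (x : (doubleCarriers D.carriers).Dom),
      ∀ t ∈ sphere (0:ℂ) (𝔭.rT k), ∀ (s' : SCube D.toTwoRuns → ℝ) (σ' : SCube D.toTwoRuns → ℂ), OnContour 𝔭.κ₁ (cubesListC D.toTwoRuns (printConvention D.toTwoRuns) k a b) s' σ' →
        DifferentiableOn ℂ (𝔭.cur U k s y a b x t s' σ') (ball 0 (𝔭.ϱ U k s y a b x)) ∧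
          MapsTo (𝔭.cur U k s y a b x t s' σ') (ball 0 (𝔭.ϱ U k s y a b x)) (ball 0 (𝔭.Rad x.1)))
    (hϱgt : ∀ U k s y a b x, 1 < 𝔭.ϱ U k s y a b x)
    (hϱinv : ∀ (U : D.carriers.BgB) (k : ℕ) (s : ℕ → ℝ) (y : ι), ∀ a ∈ boxes D.toTwoRuns k (𝔭.Yout k y), ∀ b ∈ famC D.toTwoRuns (printConvention D.toTwoRuns) k (𝔭.Yout k y) a,
      ∀ (j : ℕ), ∀ x ∈ srcC D.toTwoRuns (printConvention D.toTwoRuns) k a j, (𝔭.ϱ U k s y a b x)⁻¹ ≤ cdir * ℓg k j)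
    (hℓ : ∀ k j, 0 < ℓg k j) (hκ : 144 ≤ κ) (hκ₁ : 69 ≤ 𝔭.κ₁)
    (hLaℓ : ∀ k j, j ≤ k → (1296 : ℝ) * ((D.F.L : ℝ) ^ 4) ^ (k - j) * ℓg k j ^ 5 ≤ cQa * agePow ω k j)
    (hAa : ∀ U, PieceAdditiveOn (analyticClass (𝔭.DC (printConvention D.toTwoRuns) U).R) (𝔭.DC (printConvention D.toTwoRuns) U).toC)
    (hclipa : 0 ≤ clipa) (hcdir : 0 < cdir) (hhalf : ∀ k j, cdir * ℓg k j < 1 / 2)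
    (hcont : ∀ U, ∀ (k : ℕ) (s : ℕ → ℝ) (y : ι) (a : SCube D.toTwoRuns) (b : Finset (SCube D.toTwoRuns)) (x : (doubleCarriers D.carriers).Dom),
      ContinuousOn (fun q : (ℂ × ((SCube D.toTwoRuns → ℝ) × (SCube D.toTwoRuns → ℂ))) × ℂ => (𝔭.DC (printConvention D.toTwoRuns) U).cur k s y a b x q.1.1 q.1.2.1 q.1.2.2 q.2)
        ((sphere (0:ℂ) ((𝔭.DC (printConvention D.toTwoRuns) U).r k) ×ˢ {q | OnContour (𝔭.DC (printConvention D.toTwoRuns) U).κ₁ ((𝔭.DC (printConvention D.toTwoRuns) U).cubes k y a b) q.1 q.2}) ×ˢ sphere (0:ℂ) 1))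
    (hlip : ∀ U, ∀ g ∈ W, ∀ g' ∈ W, ∀ (k : ℕ) (y : ι), ∀ a ∈ (𝔭.DC (printConvention D.toTwoRuns) U).S0 k y, ∀ b ∈ (𝔭.DC (printConvention D.toTwoRuns) U).SY k y a, ∀ (j : ℕ),
      ∀ x ∈ (𝔭.DC (printConvention D.toTwoRuns) U).src k y a j, ∀ t ∈ sphere (0:ℂ) ((𝔭.DC (printConvention D.toTwoRuns) U).r k), ∀ (s' : SCube D.toTwoRuns → ℝ) (σ' : SCube D.toTwoRuns → ℂ),
        OnContour (𝔭.DC (printConvention D.toTwoRuns) U).κ₁ ((𝔭.DC (printConvention D.toTwoRuns) U).cubes k y a b) s' σ' → ∀ τ ∈ ball (0:ℂ) (1 / (2 * (cdir * ℓg k j))),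
          ‖(𝔭.DC (printConvention D.toTwoRuns) U).cur k g y a b x t s' σ' τ - (𝔭.DC (printConvention D.toTwoRuns) U).cur k g' y a b x t s' σ' τ‖ ≤ clipa * ((𝔭.DC (printConvention D.toTwoRuns) U).R x.1 / 2) * |g k - g' k|)
    (hroom : ∀ U, ∀ g ∈ W, ∀ (k : ℕ) (y : ι), ∀ a ∈ (𝔭.DC (printConvention D.toTwoRuns) U).S0 k y, ∀ b ∈ (𝔭.DC (printConvention D.toTwoRuns) U).SY k y a, ∀ (j : ℕ), ∀ x ∈ (𝔭.DC (printConvention D.toTwoRuns) U).src k y a j,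
      ∀ t ∈ sphere (0:ℂ) ((𝔭.DC (printConvention D.toTwoRuns) U).r k), ∀ (s' : SCube D.toTwoRuns → ℝ) (σ' : SCube D.toTwoRuns → ℂ), OnContour (𝔭.DC (printConvention D.toTwoRuns) U).κ₁ ((𝔭.DC (printConvention D.toTwoRuns) U).cubes k y a b) s' σ' →
        ∀ τ ∈ ball (0:ℂ) (1 / (2 * (cdir * ℓg k j))), ‖(𝔭.DC (printConvention D.toTwoRuns) U).cur k g y a b x t s' σ' τ‖ ≤ (𝔭.DC (printConvention D.toTwoRuns) U).R x.1 / 2)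
    -- species (b): the analytic ∕ geometric clauses of `KerData.Admissible` at the data of record, and the letters
    (hzero : ∀ U k s y a b x t s' σ' p q, 𝔭.ker U k s y a b x t s' σ' p q (0 : TowerData (D.F.P (D.K + 1)) o → ℂ) = 0)
    (hkerB : ∀ (U : D.carriers.BgB) (k : ℕ) (s : ℕ → ℝ) (y : ι), ∀ a ∈ boxes D.toTwoRuns k (𝔭.Yout k y), ∀ b ∈ famC D.toTwoRuns (printConvention D.toTwoRuns) k (𝔭.Yout k y) a, ∀ (j : ℕ),
      ∀ x ∈ srcC D.toTwoRuns (printConvention D.toTwoRuns) k a j, ∀ t ∈ sphere (0:ℂ) (𝔭.rT k), ∀ (s' : SCube D.toTwoRuns → ℝ) (σ' : SCube D.toTwoRuns → ℂ),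
        OnContour 𝔭.κ₁ (cubesListC D.toTwoRuns (printConvention D.toTwoRuns) k a b) s' σ' → ∀ p ∈ 𝔭.pts k y a, ∀ q ∈ 𝔭.pts k y a, ∀ (F : TowerData (D.F.P (D.K + 1)) o → ℂ) (M : ℝ),
          DifferentiableOn ℂ F (ball 0 (𝔭.Rad x.1)) → (∀ z ∈ ball (0 : TowerData (D.F.P (D.K + 1)) o) (𝔭.Rad x.1), ‖F z‖ ≤ M) →
            ‖𝔭.ker U k s y a b x t s' σ' p q F‖ ≤
              cK * M * gain k j * 𝔭.ρd p q ^ 𝔭.m * Real.exp (-(δ₀ * (𝔭.dX x.1 p + 𝔭.dX x.1 q))))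
    (hgeom : ∀ (k : ℕ) (y : ι) (a : SCube D.toTwoRuns) (x : (doubleCarriers D.carriers).Dom), ∀ p ∈ 𝔭.pts k y a, ∀ q ∈ 𝔭.pts k y a,
      δ₁ * 𝔭.ρd (𝔭.p0 x.1) p + δ₁ * 𝔭.ρd p q ≤ δ₀ * (𝔭.dX x.1 p + 𝔭.dX x.1 q) + w * D.carriers.d x.1 + w0)
    (hsum0 : ∀ (k : ℕ) (y : ι) (a : SCube D.toTwoRuns) (X : D.carriers.Dom), ∑ p ∈ 𝔭.pts k y a, Real.exp (-(δ₁ * 𝔭.ρd (𝔭.p0 X) p)) ≤ c0)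
    (hsum1 : ∀ (k : ℕ) (y : ι) (a : SCube D.toTwoRuns), ∀ p ∈ 𝔭.pts k y a,
      ∑ q ∈ 𝔭.pts k y a, 𝔭.ρd p q ^ 𝔭.m * Real.exp (-(δ₁ * 𝔭.ρd p q)) ≤ c1)
    (hcK : 0 ≤ cK) (hgain : ∀ k j, 0 ≤ gain k j) (hρd : ∀ p q, 0 ≤ 𝔭.ρd p q) (hc0 : 0 ≤ c0) (hc1 : 0 ≤ c1)
    (hκw : 144 ≤ κ - w) (hLbℓ : ∀ k j, j ≤ k → (1296 : ℝ) * ((D.F.L : ℝ) ^ 4) ^ (k - j) * gain k j ≤ cQb * agePow ω k j)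
    (hAb : ∀ U, PieceAdditiveOn (analyticClass (𝔭.KC (printConvention D.toTwoRuns) U).R) (𝔭.KC (printConvention D.toTwoRuns) U).toC) (hlam : 0 ≤ lam)
    (hkerC : ∀ U, ∀ (k : ℕ) (s : ℕ → ℝ) (y : ι) (a : SCube D.toTwoRuns) (b : Finset (SCube D.toTwoRuns)) (x : (doubleCarriers D.carriers).Dom),
      ∀ p ∈ (𝔭.KC (printConvention D.toTwoRuns) U).pts k y a, ∀ q ∈ (𝔭.KC (printConvention D.toTwoRuns) U).pts k y a, ∀ F : TowerData (D.F.P (D.K + 1)) o → ℂ, DifferentiableOn ℂ F (ball 0 ((𝔭.KC (printConvention D.toTwoRuns) U).R x.1)) →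
        Continuous fun wv : ℂ × (SCube D.toTwoRuns → ℝ) × (SCube D.toTwoRuns → ℂ) => (𝔭.KC (printConvention D.toTwoRuns) U).ker k s y a b x wv.1 wv.2.1 wv.2.2 p q F)
    (hkerL : ∀ U, ∀ g ∈ W, ∀ g' ∈ W, ∀ (k : ℕ) (y : ι), ∀ a ∈ (𝔭.KC (printConvention D.toTwoRuns) U).S0 k y, ∀ b ∈ (𝔭.KC (printConvention D.toTwoRuns) U).SY k y a, ∀ (j : ℕ),
      ∀ x ∈ (𝔭.KC (printConvention D.toTwoRuns) U).src k y a j, ∀ t ∈ sphere (0:ℂ) ((𝔭.KC (printConvention D.toTwoRuns) U).r k), ∀ (s' : SCube D.toTwoRuns → ℝ) (σ' : SCube D.toTwoRuns → ℂ),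
        OnContour (𝔭.KC (printConvention D.toTwoRuns) U).κ₁ ((𝔭.KC (printConvention D.toTwoRuns) U).cubes k y a b) s' σ' → ∀ p ∈ (𝔭.KC (printConvention D.toTwoRuns) U).pts k y a, ∀ q ∈ (𝔭.KC (printConvention D.toTwoRuns) U).pts k y a,
          ∀ (F : TowerData (D.F.P (D.K + 1)) o → ℂ) (M : ℝ), DifferentiableOn ℂ F (ball 0 ((𝔭.KC (printConvention D.toTwoRuns) U).R x.1)) → (∀ z ∈ ball (0 : TowerData (D.F.P (D.K + 1)) o) ((𝔭.KC (printConvention D.toTwoRuns) U).R x.1), ‖F z‖ ≤ M) →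
            ‖(𝔭.KC (printConvention D.toTwoRuns) U).ker k g y a b x t s' σ' p q F - (𝔭.KC (printConvention D.toTwoRuns) U).ker k g' y a b x t s' σ' p q F‖ ≤
              cK * lam * M * gain k j * (𝔭.KC (printConvention D.toTwoRuns) U).ρd p q ^ (𝔭.KC (printConvention D.toTwoRuns) U).m * Real.exp (-(δ₀ * ((𝔭.KC (printConvention D.toTwoRuns) U).dX x.1 p + (𝔭.KC (printConvention D.toTwoRuns) U).dX x.1 q))) *
                |g k - g' k|)
    (hcQa : 0 ≤ cQa) (hcQb : 0 ≤ cQb) (hMF : ∀ U, MF U ⊆ analyticClass (𝔭.DC (printConvention D.toTwoRuns) U).R)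
    -- the recursion data, per chart
    (U₀ : D.carriers.BgB → TowerData (D.F.P (D.K + 1)) o)
    (explZ : D.carriers.BgB → ℕ → TowerData (D.F.P (D.K + 1)) o → (doubleCarriers D.carriers).Dom → ℝ)
    (base : D.carriers.BgB → TowerData (D.F.P (D.K + 1)) o → (doubleCarriers D.carriers).Dom → ℝ)
    (hAdm : ∀ U, AdmissibleTerms (EfOf (GoR D) (actOR D ιR cR aR sR P 𝒵 dom Jc VR mI L dk gc pQ pR ρ cc wR U) (weightOf (𝔭.DC (printConvention D.toTwoRuns) U).toC.frame (𝔭.DC (printConvention D.toTwoRuns) U).κ₁ (1 + (printConvention D.toTwoRuns).nA + (printConvention D.toTwoRuns).nB) (2 * (2 ^ 20 + 1)) ((𝔭.DC (printConvention D.toTwoRuns) U).Kp cdir + (𝔭.KC (printConvention D.toTwoRuns) U).Kp cK w0 c0 c1))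
      (U₀ U) (explZ U) (base U) (cpieceChannel (𝔭.DC (printConvention D.toTwoRuns) U).toC + cpieceChannel (𝔭.KC (printConvention D.toTwoRuns) U).toC) (margProj (shiftRead (Pr U).recipe) (A U))) W (Adm U))
    (hres : ∀ U, AdmRestrict (Adm U))
    -- RO DISCHARGED (`NE9ChartReadOut`): a finite chart-probe recipe per real background, chart radius `αr`, locality letter `Kr`,
    -- and the admissible old terms probe-analytic
    (hαr : 0 < αr)
    (hKr : ∀ (U : D.carriers.BgB) (k : ℕ), ∑ p ∈ (Pr U).idx k, |(Pr U).wt k p| * ‖(Pr U).dirA k p‖ * ‖(Pr U).dirB k p‖ *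
      Real.exp (-(κ * D.carriers.d ((Pr U).dom k p))) ≤ Kr)
    (hAn : ∀ U, Adm U ⊆ (Pr U).Analytic αr)
    (hA : ∀ U, DirSize (A U) κ aA) (haA : 0 ≤ aA) (hPinto : ∀ U, ProjInto (Adm U) (MF U) (margProj (shiftRead (Pr U).recipe) (A U)))
    (hclip0 : ∀ k, 0 ≤ clip k)
    (hCup : ∀ U, ∀ g ∈ W, ∀ g' ∈ W, ∀ (k : ℕ) (Vc : TowerData (D.F.P (D.K + 1)) o) (X : (doubleCarriers D.carriers).Dom), (doubleCarriers D.carriers).scale X = k + 1 →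
      ∀ Q ∈ admOf (GoR D) (actOR D ιR cR aR sR P 𝒵 dom Jc VR mI L dk gc pQ pR ρ cc wR U) (weightOf (𝔭.DC (printConvention D.toTwoRuns) U).toC.frame (𝔭.DC (printConvention D.toTwoRuns) U).κ₁ (1 + (printConvention D.toTwoRuns).nA + (printConvention D.toTwoRuns).nB) (2 * (2 ^ 20 + 1)) ((𝔭.DC (printConvention D.toTwoRuns) U).Kp cdir + (𝔭.KC (printConvention D.toTwoRuns) U).Kp cK w0 c0 c1)) (U₀ U) (explZ U)
        (base U) (cpieceChannel (𝔭.DC (printConvention D.toTwoRuns) U).toC + cpieceChannel (𝔭.KC (printConvention D.toTwoRuns) U).toC) (margProj (shiftRead (Pr U).recipe) (A U)) W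
        (fun k => sizeRadius (fun k j => (1 + (8 * Kr / αr ^ 2) * aA) * (tauOfG cQa (agePow ω) + tauOfG cQb (agePow ω)) k j) N k) k,
      ∀ γ' ∈ (GoR D).vol X,
        ‖actOR D ιR cR aR sR P 𝒵 dom Jc VR mI L dk gc pQ pR ρ cc wR U k (g k) Vc Q γ'‖ ≤ n U k (g' k) Vc γ' ∧
          ‖actOR D ιR cR aR sR P 𝒵 dom Jc VR mI L dk gc pQ pR ρ cc wR U k (g k) Vc Q γ' -
              actOR D ιR cR aR sR P 𝒵 dom Jc VR mI L dk gc pQ pR ρ cc wR U k (g' k) Vc Q γ'‖ ≤ clip k * |g k - g' k| * n U k (g' k) Vc γ')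
    (hclipb : ∀ k, clip k ≤ clipbar) (hNb : ∀ j, N j ≤ Nbar)
    (hqTb : (64 * clipa * cQa + lam * cQb) * ((1 + (8 * Kr / αr ^ 2) * aA) * Nbar) * (1 - ω)⁻¹ ≤ qTbar)
    (hKP : ∀ U, TwoPointKP (GoR D) W (actOR D ιR cR aR sR P 𝒵 dom Jc VR mI L dk gc pQ pR ρ cc wR U) (admOf (GoR D) (actOR D ιR cR aR sR P 𝒵 dom Jc VR mI L dk gc pQ pR ρ cc wR U) (weightOf (𝔭.DC (printConvention D.toTwoRuns) U).toC.frame (𝔭.DC (printConvention D.toTwoRuns) U).κ₁ (1 + (printConvention D.toTwoRuns).nA + (printConvention D.toTwoRuns).nB) (2 * (2 ^ 20 + 1)) ((𝔭.DC (printConvention D.toTwoRuns) U).Kp cdir + (𝔭.KC (printConvention D.toTwoRuns) U).Kp cK w0 c0 c1))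
      (U₀ U) (explZ U) (base U) (cpieceChannel (𝔭.DC (printConvention D.toTwoRuns) U).toC + cpieceChannel (𝔭.KC (printConvention D.toTwoRuns) U).toC) (margProj (shiftRead (Pr U).recipe) (A U)) W
      (fun k => sizeRadius (fun k j => (1 + (8 * Kr / αr ^ 2) * aA) * (tauOfG cQa (agePow ω) + tauOfG cQb (agePow ω)) k j) N k)) (n U) lip a d)
    (hdec : (GoR D).DecayExtract δv d) (hpin : (GoR D).PinBudget a δv (fun _ => B) κ)
    (hexplZ : ∀ U, ∀ (k : ℕ) (Vc : TowerData (D.F.P (D.K + 1)) o) (X : (doubleCarriers D.carriers).Dom), (doubleCarriers D.carriers).scale X = k + 1 →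
      |explZ U k Vc X| ≤ Real.exp (-(κ * (doubleCarriers D.carriers).d X)) * p₀ k)
    (hbase0 : ∀ U, ∀ (Vc : TowerData (D.F.P (D.K + 1)) o) (X : (doubleCarriers D.carriers).Dom), (doubleCarriers D.carriers).scale X = 0 →
      |base U Vc X| ≤ Real.exp (-(κ * (doubleCarriers D.carriers).d X)) * N 0)
    (hNsucc : ∀ j, p₀ j + 2 * B ≤ N (j + 1)) (hNnn : ∀ j, 0 ≤ N j)
    (hB : 0 ≤ B) (hlipb : ∀ k, lip k ≤ lipbar) (hω : 0 ≤ ω) (hω1 : ω < 1)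
    (hpos : 0 < ω + 8 * lipbar * B * ((1 + (8 * Kr / αr ^ 2) * aA) * (cQa + cQb))) :
    TermSize (EreOf (GoR D) (actOR D ιR cR aR sR P 𝒵 dom Jc VR mI L dk gc pQ pR ρ cc wR) (fun U => weightOf (𝔭.DC (printConvention D.toTwoRuns) U).toC.frame (𝔭.DC (printConvention D.toTwoRuns) U).κ₁ (1 + (printConvention D.toTwoRuns).nA + (printConvention D.toTwoRuns).nB) (2 * (2 ^ 20 + 1)) ((𝔭.DC (printConvention D.toTwoRuns) U).Kp cdir + (𝔭.KC (printConvention D.toTwoRuns) U).Kp cK w0 c0 c1)) U₀ explZ base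
        (fun U => cpieceChannel (𝔭.DC (printConvention D.toTwoRuns) U).toC + cpieceChannel (𝔭.KC (printConvention D.toTwoRuns) U).toC) (fun U => margProj (shiftRead (Pr U).recipe) (A U)) (fun _ => 0)) W κ N ∧
      NE9 (EreOf (GoR D) (actOR D ιR cR aR sR P 𝒵 dom Jc VR mI L dk gc pQ pR ρ cc wR) (fun U => weightOf (𝔭.DC (printConvention D.toTwoRuns) U).toC.frame (𝔭.DC (printConvention D.toTwoRuns) U).κ₁ (1 + (printConvention D.toTwoRuns).nA + (printConvention D.toTwoRuns).nB) (2 * (2 ^ 20 + 1)) ((𝔭.DC (printConvention D.toTwoRuns) U).Kp cdir + (𝔭.KC (printConvention D.toTwoRuns) U).Kp cK w0 c0 c1)) U₀ explZ base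
        (fun U => cpieceChannel (𝔭.DC (printConvention D.toTwoRuns) U).toC + cpieceChannel (𝔭.KC (printConvention D.toTwoRuns) U).toC) (fun U => margProj (shiftRead (Pr U).recipe) (A U)) (fun _ => 0)) W κ
        (prodModuli (8 * clipbar * B + 8 * lipbar * B * qTbar) fun _ => ω + 8 * lipbar * B * ((1 + (8 * Kr / αr ^ 2) * aA) * (cQa + cQb))) ∧
        FadingMemory ((8 * clipbar * B + 8 * lipbar * B * qTbar) / (ω + 8 * lipbar * B * ((1 + (8 * Kr / αr ^ 2) * aA) * (cQa + cQb))))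
          (ω + 8 * lipbar * B * ((1 + (8 * Kr / αr ^ 2) * aA) * (cQa + cQb)))
          (prodModuli (8 * clipbar * B + 8 * lipbar * B * qTbar)
            fun _ => ω + 8 * lipbar * B * ((1 + (8 * Kr / αr ^ 2) * aA) * (cQa + cQb))) :=
  termSize_ne9_and_fadingMemory_centre D ιR cR aR sR P 𝒵 dom Jc VR mI L dk gc pQ pR ρ cc wR U₁ 𝔭 ℓk hκ₁1 hrT hRad hcur
    hϱgt hϱinv hℓ hκ hκ₁ hLaℓ hAa hclipa hcdir hhalf hcont hlip hroom hzero hkerB hgeom hsum0 hsum1 hcK hgain hρd hc0 hc1 hκw hLbℓ hAb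
    hlam hkerC hkerL hcQa hcQb hMF U₀ explZ base hAdm hres (fun U => readAdditive_shiftRead_recipe (Pr U) hαr (hAn U))
    (fun U => readZero_shiftRead_recipe (Pr U)) (fun U => readSize_shiftRead_recipe (Pr U) hαr (hKr U) (hAn U)) hA
    (readConst_nonneg (Pr U₁) (hKr U₁)) haA hPinto hclip0 hCup hclipb hNb hqTb hKP hdec hpin hexplZ hbase0 hNsucc hNnn hB hlipb hω hω1 hpos

end Summit.QuantumFields.BalabanUV.T4Continuum.NE9EndOfRecordReadOut

end
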